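/-
Copyright: cell `pub-balaban-gaps` (G2), seat ne6 (row NE7b), `prover-pub-balaban-gaps-ne6-g20-0`. Project licence.
-/
import Summits.QuantumFields.BalabanUV.T4Continuum.Spine.NE7b.CompactFibreMeanActionSUNMonotone
import Mathlib.Algebra.QuadraticDiscriminant

/-!
# THE TILTED MEAN ACTION's DERIVATIVE IS MINUS THE VARIANCE, EVERY `N`: `d∕dβ ⟨Re tr(1−V)⟩_β = −Var_β(Re tr(1−V)) ≤ 0` — THE CURVATURE OF THE FREE ENERGY
# `(−log Z_N)″ = −Var_β` NAMED (row NE7b, node U5c; MODEL, [folklore]; census V56)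

Cell `pub-balaban-gaps` (G2 spine census) for the `pub-balaban` T⁴ crux NE7b (`T4WeightBudget.RelWeightBound`; NOT PRINTED, NOT PROVED).  Crux-route work under
`Spine/NE7b/`; imports the landed V50 `CompactFibreMeanActionSUNMonotone` (`hasDerivAt_plaquetteMass_SUN`, `plaquetteMass_SUN_pos_real`; it re-exports V38's
`measurable_re_trace_one_sub` ∕ `re_trace_one_sub_le_two_mul` and V35's `re_trace_one_sub_nonneg`) + Mathlib (dominated differentiation `hasDerivAt_integral_of_dominated_loc_of_deriv_le`, `HasDerivAt.div`,
`discrim_le_zero`); no `def`, zero `sorry`, nothing of Bałaban's asserted.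

THE LOCATED QUESTION.  V50 proved `(−log Z_N)′ = ⟨s⟩_β` (`s = Re tr(1 − V)`, one `SU(N)` plaquette under `e^{−βs}dHaar∕Z_N(β)`) and that `⟨s⟩_β` is ANTITONE on `[0, ∞)` (a
correlation inequality), hence `−log Z_N` concave there; gen 20's V55 computes the weak-coupling limit of the VARIANCE for N = 2 from the moments and remarks that the
identification `Var_β(s) = −⟨s⟩_β′ = (log Z_N)″` is not in the tree.  QUESTION (V56): name the curvature, every N, every real β.  ANSWER ([folklore]; on a finite measure space
with a measurable deficit `0 ≤ s ≤ B`: `Z = ∫e^{−βs}dμ`, `M = ∫s·e^{−βs}dμ`, `W = ∫s²·e^{−βs}dμ`):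
* §1 ABSTRACT **`integrable_pow_mul_exp_neg_mul`** (`s^k·e^{−βs}` integrable), **`hasDerivAt_integral_mul_exp_neg_mul`**: `M′(β₀) = −W(β₀)` (dominated differentiation,
  majorant `B²·e^{B(|β₀|+1)}` on `|β − β₀| < 1`); **`integral_sq_sub_mul_exp_eq`**: `∫(s − c)²e^{−βs}dμ = W − 2cM + c²Z`; **`sq_integral_mul_exp_le`**: `M² ≤ W·Z`
  (the quadratic `c ↦ Zc² − 2Mc + W` is non-negative, `discrim_le_zero`);
* §2 `SU(N)`, EVERY N, EVERY REAL β: **`hasDerivAt_firstMoment_SUN`** (`M′ = −W`), **`hasDerivAt_meanAction_SUN`**: `d∕dβ (M∕Z) = −(W∕Z − (M∕Z)²)` — THE DERIVATIVE OF THE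
  TILTED MEAN ACTION IS MINUS THE VARIANCE; **`actionVariance_SUN_nonneg`**: `0 ≤ W∕Z − (M∕Z)²`; **`deriv_meanAction_SUN_nonpos`** (V50's antitonicity pointwise, with the
  derivative named; all real β, not only `β ≥ 0`); **`meanAction_SUN_antitone`**: `β ↦ ⟨s⟩_β` is antitone on ALL of `ℝ`.

HONEST REMARKS.  (i) MODEL ∕ [folklore]: Haar calculus of ONE `SU(N)` plaquette variable; nothing of the interacting measure.  (ii) No limit statements here (N = 2's
`β²·Var_β → 3∕2` is V55; the all-N `β²·Var_β → (N²−1)∕2` would need a second-order layer cake — not done).  (iii) (A3) ∕ (A1c) NOT asserted; NC-NE7b-α UNRULED.  BY-NAME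
EFFECT ON THE WALL: NONE.  NE7b NOT PRINTED ∕ NOT PROVED; spine PROVED 0∕9; rung (B)+1 on ONE finite T⁴ — NOT infinite volume, NOT the mass gap, NOT Clay.
HONEST DEPENDENCY: continuum YM on T⁴ ⇐ BetaPertH ∧ nine spine estimates (0/9 proved); BetaPertH ⇐ (D1) ∧ (D4) ∧ CAP+tail;
G-an2-4 gates asym, D1 and NE2/3/4.  This file changes none of it.
-/

set_option autoImplicit false

noncomputable section

open Real Set MeasureTheory Filter Topology Metric
open Literature.MathematicalPhysics.QuantumFieldTheory (haarProbability)
open Summit.QuantumFields.BalabanUV.T4Continuum.NE7b.CompactFibreHalvedActionSUN (measurable_re_trace_one_sub re_trace_one_sub_le_two_mul)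
open Summit.QuantumFields.BalabanUV.T4Continuum.NE7b.CompactFibreProfileVolumeSUN (re_trace_one_sub_nonneg)
open Summit.QuantumFields.BalabanUV.T4Continuum.NE7b.CompactFibreMeanActionSUNMonotone (hasDerivAt_plaquetteMass_SUN plaquetteMass_SUN_pos_real)

namespace Summit.QuantumFields.BalabanUV.T4Continuum.NE7b.CompactFibreMeanActionSUNDeriv

/-! ### §1 Abstract: `M′ = −W` and `M² ≤ W·Z` -/

/-- `s^k·e^{−βs}` is integrable on a finite measure space when `0 ≤ s ≤ B` is measurable (bound `B^k·e^{|β|B}`). [folklore] -/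
theorem integrable_pow_mul_exp_neg_mul {X : Type*} [MeasurableSpace X] (μ : Measure X) [IsFiniteMeasure μ] {s : X → ℝ} (hsm : Measurable s)
    {B : ℝ} (hs0 : ∀ x, 0 ≤ s x) (hsB : ∀ x, s x ≤ B) (β : ℝ) (k : ℕ) :
    Integrable (fun x => s x ^ k * Real.exp (-(β * s x))) μ := by
  refine Integrable.of_bound ((hsm.pow_const k).mul (Real.measurable_exp.comp ((hsm.const_mul β).neg))).aestronglyMeasurable (B ^ k * Real.exp (|β| * B))
    (ae_of_all _ fun x => ?_)
  rw [Real.norm_eq_abs, abs_mul, abs_of_nonneg (pow_nonneg (hs0 x) k), abs_of_pos (Real.exp_pos _)]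
  have hB : 0 ≤ B := le_trans (hs0 x) (hsB x)
  have h1 : s x ^ k ≤ B ^ k := pow_le_pow_left₀ (hs0 x) (hsB x) k
  have h3 : -(β * s x) ≤ |β| * s x := by
    rw [← neg_mul]; exact mul_le_mul_of_nonneg_right (neg_le_abs β) (hs0 x)
  have h4 : |β| * s x ≤ |β| * B := mul_le_mul_of_nonneg_left (hsB x) (abs_nonneg β)
  have h2 : Real.exp (-(β * s x)) ≤ Real.exp (|β| * B) := Real.exp_le_exp.2 (by linarith)
  exact mul_le_mul h1 h2 (Real.exp_pos _).le (pow_nonneg hB k)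

/-- ABSTRACT: on a finite measure space with a measurable deficit `0 ≤ s ≤ B`, `β ↦ ∫ s·e^{−β·s} dμ` has derivative `−∫ s²·e^{−β₀·s} dμ` at every real `β₀`
(dominated differentiation; `|s²e^{−βs}| ≤ B²·e^{B(|β₀|+1)}` for `|β − β₀| < 1`). [folklore] -/
theorem hasDerivAt_integral_mul_exp_neg_mul {X : Type*} [MeasurableSpace X] (μ : Measure X) [IsFiniteMeasure μ] {s : X → ℝ} (hsm : Measurable s)
    {B : ℝ} (hs0 : ∀ x, 0 ≤ s x) (hsB : ∀ x, s x ≤ B) (β₀ : ℝ) :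
    HasDerivAt (fun β : ℝ => ∫ x, s x * Real.exp (-(β * s x)) ∂μ) (-(∫ x, s x ^ 2 * Real.exp (-(β₀ * s x)) ∂μ)) β₀ := by
  set K : ℝ := Real.exp (B * (|β₀| + 1)) with hK
  have hexpK : ∀ β : ℝ, |β - β₀| < 1 → ∀ x, Real.exp (-(β * s x)) ≤ K := fun β hβ x => by
    have hβ' : |β| ≤ |β₀| + 1 := by have := abs_sub_abs_le_abs_sub β β₀; linarith
    have h1 : -(β * s x) ≤ |β| * s x := by
      have h := neg_abs_le β
      have := mul_le_mul_of_nonneg_right h (hs0 x)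
      linarith
    have h2 : |β| * s x ≤ (|β₀| + 1) * B := mul_le_mul hβ' (hsB x) (hs0 x) (by positivity)
    rw [hK, Real.exp_le_exp]
    linarith
  have hball : ∀ β : ℝ, β ∈ ball β₀ 1 → |β - β₀| < 1 := fun β hβ => by
    rwa [mem_ball_iff_norm, Real.norm_eq_abs] at hβ
  have hmeas : ∀ β : ℝ, Measurable fun x => s x * Real.exp (-(β * s x)) := fun β => hsm.mul (Real.measurable_exp.comp ((hsm.const_mul β).neg))
  have hF_meas : ∀ᶠ β in 𝓝 β₀, AEStronglyMeasurable (fun x => s x * Real.exp (-(β * s x))) μ :=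
    Filter.Eventually.of_forall fun β => (hmeas β).aestronglyMeasurable
  have hF_int : Integrable (fun x => s x * Real.exp (-(β₀ * s x))) μ := by
    have h := integrable_pow_mul_exp_neg_mul μ hsm hs0 hsB β₀ 1
    simpa only [pow_one] using h
  have hF'_meas : AEStronglyMeasurable (fun x => s x * (Real.exp (-(β₀ * s x)) * (-(s x)))) μ :=
    (hsm.mul ((Real.measurable_exp.comp ((hsm.const_mul β₀).neg)).mul hsm.neg)).aestronglyMeasurable
  have h_bound : ∀ᵐ x ∂μ, ∀ β ∈ ball β₀ 1, ‖s x * (Real.exp (-(β * s x)) * (-(s x)))‖ ≤ B * (K * B) := ae_of_all _ fun x β hβ => by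
    rw [Real.norm_eq_abs, abs_mul, abs_mul, abs_neg, abs_of_nonneg (hs0 x), abs_of_pos (Real.exp_pos _)]
    have hB : 0 ≤ B := le_trans (hs0 x) (hsB x)
    have hin : Real.exp (-(β * s x)) * s x ≤ K * B :=
      mul_le_mul (hexpK β (hball β hβ) x) (hsB x) (hs0 x) (le_trans (Real.exp_pos _).le (hexpK β (hball β hβ) x))
    exact mul_le_mul (hsB x) hin (mul_nonneg (Real.exp_pos _).le (hs0 x)) hB
  have h_diff : ∀ᵐ x ∂μ, ∀ β ∈ ball β₀ 1, HasDerivAt (fun β : ℝ => s x * Real.exp (-(β * s x))) (s x * (Real.exp (-(β * s x)) * (-(s x)))) β :=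
    ae_of_all _ fun x β _ => by
      have h1 : HasDerivAt (fun b : ℝ => -(b * s x)) (-(s x)) β := by
        have h := (hasDerivAt_id' β).mul_const (-(s x))
        rw [one_mul] at h
        have e : (fun b : ℝ => b * -s x) = fun b => -(b * s x) := by funext b; ring
        rwa [e] at h
      exact h1.exp.const_mul (s x)
  have h := (hasDerivAt_integral_of_dominated_loc_of_deriv_le (ball_mem_nhds β₀ one_pos) hF_meas hF_int hF'_meas h_bound (integrable_const _) h_diff).2
  have hrew : ∫ x, s x * (Real.exp (-(β₀ * s x)) * (-(s x))) ∂μ = -(∫ x, s x ^ 2 * Real.exp (-(β₀ * s x)) ∂μ) := by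
    rw [← integral_neg]; congr 1; funext x; ring
  rw [hrew] at h
  exact h

/-- `∫(s − c)²·e^{−βs} dμ = W − 2c·M + c²·Z`. [folklore] -/
theorem integral_sq_sub_mul_exp_eq {X : Type*} [MeasurableSpace X] (μ : Measure X) [IsFiniteMeasure μ] {s : X → ℝ} (hsm : Measurable s)
    {B : ℝ} (hs0 : ∀ x, 0 ≤ s x) (hsB : ∀ x, s x ≤ B) (β c : ℝ) :
    ∫ x, (s x - c) ^ 2 * Real.exp (-(β * s x)) ∂μ
      = (∫ x, s x ^ 2 * Real.exp (-(β * s x)) ∂μ) - 2 * c * (∫ x, s x * Real.exp (-(β * s x)) ∂μ) + c ^ 2 * ∫ x, Real.exp (-(β * s x)) ∂μ := by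
  have h2 := integrable_pow_mul_exp_neg_mul μ hsm hs0 hsB β 2
  have h1 : Integrable (fun x => s x * Real.exp (-(β * s x))) μ := by
    simpa only [pow_one] using integrable_pow_mul_exp_neg_mul μ hsm hs0 hsB β 1
  have h0 : Integrable (fun x => Real.exp (-(β * s x))) μ := by
    simpa only [pow_zero, one_mul] using integrable_pow_mul_exp_neg_mul μ hsm hs0 hsB β 0
  have e : (fun x => (s x - c) ^ 2 * Real.exp (-(β * s x)))
      = fun x => (s x ^ 2 * Real.exp (-(β * s x)) - 2 * c * (s x * Real.exp (-(β * s x)))) + c ^ 2 * Real.exp (-(β * s x)) := by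
    funext x; ring
  have hA : Integrable (fun x => s x ^ 2 * Real.exp (-(β * s x)) - 2 * c * (s x * Real.exp (-(β * s x)))) μ := h2.sub (h1.const_mul _)
  have hB' : Integrable (fun x => c ^ 2 * Real.exp (-(β * s x))) μ := h0.const_mul _
  rw [e, integral_add hA hB', integral_sub h2 (h1.const_mul _), integral_const_mul, integral_const_mul]

/-- **`M² ≤ W·Z`** (`(∫s·e^{−βs})² ≤ (∫s²·e^{−βs})·(∫e^{−βs})`): the quadratic `c ↦ Z·c² − 2M·c + W = ∫(s − c)²e^{−βs} ≥ 0` has non-positive discriminant. [folklore] -/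
theorem sq_integral_mul_exp_le {X : Type*} [MeasurableSpace X] (μ : Measure X) [IsFiniteMeasure μ] {s : X → ℝ} (hsm : Measurable s)
    {B : ℝ} (hs0 : ∀ x, 0 ≤ s x) (hsB : ∀ x, s x ≤ B) (β : ℝ) :
    (∫ x, s x * Real.exp (-(β * s x)) ∂μ) ^ 2 ≤ (∫ x, s x ^ 2 * Real.exp (-(β * s x)) ∂μ) * ∫ x, Real.exp (-(β * s x)) ∂μ := by
  have hq : ∀ c : ℝ, 0 ≤ (∫ x, Real.exp (-(β * s x)) ∂μ) * (c * c) + (-(2 * ∫ x, s x * Real.exp (-(β * s x)) ∂μ)) * c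
      + ∫ x, s x ^ 2 * Real.exp (-(β * s x)) ∂μ := fun c => by
    have h := integral_nonneg (μ := μ) (f := fun x => (s x - c) ^ 2 * Real.exp (-(β * s x))) fun x => mul_nonneg (sq_nonneg _) (Real.exp_pos _).le
    rw [integral_sq_sub_mul_exp_eq μ hsm hs0 hsB β c] at h
    linarith
  have hd := discrim_le_zero hq
  rw [discrim] at hd
  nlinarith [hd]

/-! ### §2 `SU(N)`: the mean action's derivative and the free energy's curvature -/

variable {N : ℕ}

/-- **`M′ = −W` ON `SU(N)`, EVERY REAL `β`**: `d∕dβ ∫ s·e^{−βs} dHaar = −∫ s²·e^{−βs} dHaar`, `s = Re tr(1−V)` (`0 ≤ s ≤ 2N`). [folklore] -/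
theorem hasDerivAt_firstMoment_SUN (β₀ : ℝ) :
    HasDerivAt (fun β : ℝ => ∫ V, (Matrix.trace (1 - (V : Matrix (Fin N) (Fin N) ℂ))).re * Real.exp (-(β * (Matrix.trace (1 - (V : Matrix (Fin N) (Fin N) ℂ))).re))
        ∂(haarProbability (Matrix.specialUnitaryGroup (Fin N) ℂ)))
      (-(∫ V, (Matrix.trace (1 - (V : Matrix (Fin N) (Fin N) ℂ))).re ^ 2 * Real.exp (-(β₀ * (Matrix.trace (1 - (V : Matrix (Fin N) (Fin N) ℂ))).re))
        ∂(haarProbability (Matrix.specialUnitaryGroup (Fin N) ℂ)))) β₀ :=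
  hasDerivAt_integral_mul_exp_neg_mul (haarProbability (Matrix.specialUnitaryGroup (Fin N) ℂ)) measurable_re_trace_one_sub
    re_trace_one_sub_nonneg re_trace_one_sub_le_two_mul β₀

/-- **THE VARIANCE IS NON-NEGATIVE**: `0 ≤ W∕Z − (M∕Z)²` for every real `β` (`M² ≤ WZ`, `Z > 0`). [folklore] -/
theorem actionVariance_SUN_nonneg (β : ℝ) :
    0 ≤ (∫ V, (Matrix.trace (1 - (V : Matrix (Fin N) (Fin N) ℂ))).re ^ 2 * Real.exp (-(β * (Matrix.trace (1 - (V : Matrix (Fin N) (Fin N) ℂ))).re))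
          ∂(haarProbability (Matrix.specialUnitaryGroup (Fin N) ℂ)))
        / (∫ V, Real.exp (-(β * (Matrix.trace (1 - (V : Matrix (Fin N) (Fin N) ℂ))).re)) ∂(haarProbability (Matrix.specialUnitaryGroup (Fin N) ℂ)))
      - ((∫ V, (Matrix.trace (1 - (V : Matrix (Fin N) (Fin N) ℂ))).re * Real.exp (-(β * (Matrix.trace (1 - (V : Matrix (Fin N) (Fin N) ℂ))).re))
            ∂(haarProbability (Matrix.specialUnitaryGroup (Fin N) ℂ)))
          / ∫ V, Real.exp (-(β * (Matrix.trace (1 - (V : Matrix (Fin N) (Fin N) ℂ))).re)) ∂(haarProbability (Matrix.specialUnitaryGroup (Fin N) ℂ))) ^ 2 := by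
  have hZ := plaquetteMass_SUN_pos_real (N := N) β
  have hcs := sq_integral_mul_exp_le (haarProbability (Matrix.specialUnitaryGroup (Fin N) ℂ)) measurable_re_trace_one_sub
    re_trace_one_sub_nonneg (re_trace_one_sub_le_two_mul (N := N)) β
  rw [div_pow, sub_nonneg, div_le_div_iff₀ (pow_pos hZ 2) hZ]
  nlinarith [hcs, hZ]

/-- **THE DERIVATIVE OF THE TILTED MEAN ACTION IS MINUS THE VARIANCE, EVERY `N`, EVERY REAL `β`**:
`d∕dβ (∫s·e^{−βs}dHaar ∕ ∫e^{−βs}dHaar) = −(W∕Z − (M∕Z)²)` (`HasDerivAt.div` with V50's `Z′ = −M` and §1's `M′ = −W`). [folklore] -/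
theorem hasDerivAt_meanAction_SUN (β : ℝ) :
    HasDerivAt (fun b : ℝ =>
        (∫ V, (Matrix.trace (1 - (V : Matrix (Fin N) (Fin N) ℂ))).re * Real.exp (-(b * (Matrix.trace (1 - (V : Matrix (Fin N) (Fin N) ℂ))).re))
            ∂(haarProbability (Matrix.specialUnitaryGroup (Fin N) ℂ)))
          / ∫ V, Real.exp (-(b * (Matrix.trace (1 - (V : Matrix (Fin N) (Fin N) ℂ))).re)) ∂(haarProbability (Matrix.specialUnitaryGroup (Fin N) ℂ)))
      (-((∫ V, (Matrix.trace (1 - (V : Matrix (Fin N) (Fin N) ℂ))).re ^ 2 * Real.exp (-(β * (Matrix.trace (1 - (V : Matrix (Fin N) (Fin N) ℂ))).re))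
            ∂(haarProbability (Matrix.specialUnitaryGroup (Fin N) ℂ)))
          / (∫ V, Real.exp (-(β * (Matrix.trace (1 - (V : Matrix (Fin N) (Fin N) ℂ))).re)) ∂(haarProbability (Matrix.specialUnitaryGroup (Fin N) ℂ)))
        - ((∫ V, (Matrix.trace (1 - (V : Matrix (Fin N) (Fin N) ℂ))).re * Real.exp (-(β * (Matrix.trace (1 - (V : Matrix (Fin N) (Fin N) ℂ))).re))
              ∂(haarProbability (Matrix.specialUnitaryGroup (Fin N) ℂ)))
            / ∫ V, Real.exp (-(β * (Matrix.trace (1 - (V : Matrix (Fin N) (Fin N) ℂ))).re)) ∂(haarProbability (Matrix.specialUnitaryGroup (Fin N) ℂ))) ^ 2)) β := by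
  have hZ := plaquetteMass_SUN_pos_real (N := N) β
  have hM := hasDerivAt_firstMoment_SUN (N := N) β
  have hZ' := hasDerivAt_plaquetteMass_SUN (N := N) β
  have h := hM.div hZ' hZ.ne'
  have key : ∀ Zr Mr Wr : ℝ, Zr ≠ 0 → (-Wr * Zr - Mr * -Mr) / Zr ^ 2 = -(Wr / Zr - (Mr / Zr) ^ 2) := fun Zr Mr Wr hZr => by
    field_simp
    ring
  exact h.congr_deriv (key _ _ _ hZ.ne')

/-- **THE TILTED MEAN ACTION HAS NON-POSITIVE DERIVATIVE AT EVERY REAL `β`** (V50's antitonicity, pointwise, with the derivative named). [folklore] -/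
theorem deriv_meanAction_SUN_nonpos (β : ℝ) :
    deriv (fun b : ℝ =>
        (∫ V, (Matrix.trace (1 - (V : Matrix (Fin N) (Fin N) ℂ))).re * Real.exp (-(b * (Matrix.trace (1 - (V : Matrix (Fin N) (Fin N) ℂ))).re))
            ∂(haarProbability (Matrix.specialUnitaryGroup (Fin N) ℂ)))
          / ∫ V, Real.exp (-(b * (Matrix.trace (1 - (V : Matrix (Fin N) (Fin N) ℂ))).re)) ∂(haarProbability (Matrix.specialUnitaryGroup (Fin N) ℂ))) β ≤ 0 := by
  rw [(hasDerivAt_meanAction_SUN (N := N) β).deriv, neg_nonpos]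
  exact actionVariance_SUN_nonneg (N := N) β

/-- **`⟨s⟩_β` IS ANTITONE ON ALL OF `ℝ`, EVERY `N`** (V50 had `[0, ∞)` by a correlation inequality; here from the sign of the derivative). [folklore] -/
theorem meanAction_SUN_antitone :
    Antitone (fun b : ℝ =>
        (∫ V, (Matrix.trace (1 - (V : Matrix (Fin N) (Fin N) ℂ))).re * Real.exp (-(b * (Matrix.trace (1 - (V : Matrix (Fin N) (Fin N) ℂ))).re))
            ∂(haarProbability (Matrix.specialUnitaryGroup (Fin N) ℂ)))
          / ∫ V, Real.exp (-(b * (Matrix.trace (1 - (V : Matrix (Fin N) (Fin N) ℂ))).re)) ∂(haarProbability (Matrix.specialUnitaryGroup (Fin N) ℂ))) := by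
  refine antitone_of_deriv_nonpos (fun b => (hasDerivAt_meanAction_SUN (N := N) b).differentiableAt) fun b => ?_
  exact deriv_meanAction_SUN_nonpos (N := N) b

end Summit.QuantumFields.BalabanUV.T4Continuum.NE7b.CompactFibreMeanActionSUNDeriv

end
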